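import Summits.QuantumAdvantage.QuantumAdvantage.Theorems.LinnikCubicClassGroupsDegreeOnePrimesEscapeClassPNTFamilyZeroSum
import Summits.QuantumAdvantage.QuantumAdvantage.Theorems.LinnikCubicClassGroupsDegreeOnePrimesEscapeClassPNTSmoothed
import Summits.QuantumAdvantage.QuantumAdvantage.Theorems.LinnikCubicClassGroupsDegreeOnePrimesEscapeLowerPITSmoothedAux
import Literature.NumberTheory.LFunctions.ClassGroupLFunctionExceptionalZero
import HarnessLib

/-!
# The additive class prime number theorem, IV: the smoothed class sums, two-sided, with the
# (at most one) exceptional zero of the family — the dichotomy, with constants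

Topic `Summits/QuantumAdvantage/QuantumAdvantage/Theorems`, cell B2b-1 (linnik-cubic), PART A, the
`stub_classPNTAdditive` slice of the crux `DegreeOnePrimesEscape` (stmt-QuantumAdvantage-11543), in
DEGREE-LOCAL form.  HONEST FRAMING: the value of this file is a THEOREM — not summit progress.

For the number fields `K` of one degree `n > 1` whose family `F_ψ` obeys the log-free density bound in
`Q`-form (constants `b, D, a`; the shape of `fam_density_local`), and every `η > 0`, there are `ν, a₁, c > 0`
such that for every such `K`, with `g_x = tzTest (log x) x^{−ν}`, `F_x` its Laplace transform, `h = h_K`: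
EITHER for all `x ≥ Q^{a₁}` and all classes `C`, `‖h ψ̃_C(g_x) − F_x(−1)‖ ≤ η x`; OR there are `ψ₁ ∈ Ĉl_K`
(`χ_{ψ₁}` real) and a real zero `β₁ ∈ (1 − c/(log|d_K| + log 4), 1)` of `F_{ψ₁}` with, for all
`x ≥ Q^{a₁}` and all `C`, `‖h ψ̃_C(g_x) − F_x(−1) + ψ₁(C⁻¹) F_x(−β₁)‖ ≤ η x`
(`smoothedClassSum_dichotomy`).  The constant `c ≤ 1/(8(n² + 1))` is chosen so small that the exceptional
zero automatically lies in `(1 − 1/(8 log Q), 1)` (used downstream).  Ingredients: `fam_zeroSum_le_local`,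
`norm_classNumber_mul_smoothedPsiClass_sub_le`, the Landau–Page package `exists_exceptionalZero_const`
(reality, uniqueness, simplicity), `trivialZero_term_le(_one)`, `leftLine_term_le(_one)`, `zeroSum_main_small`.
-/

noncomputable section

open Complex Real MeasureTheory Set Filter Topology
open scoped NumberField nonZeroDivisors

namespace Summit.QuantumAdvantage.QuantumAdvantage.Theorems.DegreeOnePrimesEscape

open Literature.NumberTheory.LFunctions Literature.NumberTheory.LFunctions.NumberField
  Literature.NumberTheory.LFunctions.EntireEF Literature.NumberTheory.LFunctions.TZWeight
  Literature.NumberTheory.LFunctions.AbelianDensity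

variable {K : Type} [Field K] [NumberField K]

/-! ### Small lemmas on the family -/

/-- A zero of `F_ψ` is a zero of the `χ_ψ`-factor in the sense of the Landau–Page package. -/
theorem famZ_of_famF_eq_zero (ψ : AddChar (Additive (ClassGroup (𝓞 K))) ℂ) {ρ : ℂ} (h0 : famF K ψ ρ = 0) :
    ((toMulHom ψ).toHomUnits = 1 → dedekindZeta₁ K ρ = 0) ∧
      ((toMulHom ψ).toHomUnits ≠ 1 → classGroupLFunction₀ K (toMulHom ψ).toHomUnits ρ = 0) := by
  refine ⟨fun h1 ↦ ?_, fun h1 ↦ ?_⟩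
  · have hψ : ψ = 0 := by
      by_contra hψ; exact toHomUnits_ne_one hψ h1
    subst hψ; rwa [famF_zero] at h0
  · have hψ : ψ ≠ 0 := fun h ↦ h1 (by rw [h]; exact toHomUnits_toMulHom_zero)
    rwa [famF_of_ne hψ] at h0

/-- Monotonicity of the Landau–Page region in the constant: `1 − c/ℒ < β` and `c ≤ c₀` give `1 − c₀/ℒ < β`
(`ℒ = log|d_K| + log(|γ| + 4) > 0`). -/
theorem lpRegion_mono {c c₀ : ℝ} (hcc₀ : c ≤ c₀) {ρ : ℂ}
    (h : 1 - c / (Real.log ((NumberField.discr K).natAbs : ℝ) + Real.log (|ρ.im| + 4)) < ρ.re) :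
    1 - c₀ / (Real.log ((NumberField.discr K).natAbs : ℝ) + Real.log (|ρ.im| + 4)) < ρ.re := by
  have hlog4 : 0 < Real.log (|ρ.im| + 4) := Real.log_pos (by linarith [abs_nonneg ρ.im])
  have hlogd : 0 ≤ Real.log ((NumberField.discr K).natAbs : ℝ) := Real.log_natCast_nonneg _
  have := div_le_div_of_nonneg_right hcc₀ (by linarith : 0 ≤ Real.log ((NumberField.discr K).natAbs : ℝ) +
    Real.log (|ρ.im| + 4))
  linarith

/-- The trivial-zero term of every member: `m_ψ(0)(L + ε) ≤ 1152 e^{L/4}` (`Q ≤ e^{L/8}`, `0 ≤ ε ≤ 1 ≤ L`). -/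
theorem famMult_zero_term_le (hK : 1 < Module.finrank ℚ K) (ψ : AddChar (Additive (ClassGroup (𝓞 K))) ℂ)
    {L ε : ℝ} (hL : 1 ≤ L) (hε0 : 0 ≤ ε) (hε1 : ε ≤ 1) (hQexp : ThornerZaman.condQn K ≤ Real.exp (L / 8)) :
    (famMult K ψ 0 : ℝ) * (L + ε) ≤ 1152 * Real.exp (L / 4) := by
  by_cases hψ : ψ = 0
  · subst hψ; rw [famMult, famF_zero]; exact trivialZero_term_le_one K hK hL hε0 hε1 hQexp
  · rw [famMult, famF_of_ne hψ]; exact trivialZero_term_le K hK (toHomUnits_ne_one hψ) hL hε0 hε1 hQexp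

/-! ### The dichotomy -/

set_option maxHeartbeats 1600000 in
/-- **The smoothed class sums of a number field of degree `n`, two-sided, with the exceptional zero of the
family** (see the module docstring). -/
theorem smoothedClassSum_dichotomy (n : ℕ) (hn : 1 < n) {b D a : ℝ} (hb : 0 < b) (hD : 0 < D)
    (ha : 1 ≤ a) {η : ℝ} (hη : 0 < η) :
    ∃ ν a₁ c : ℝ, 0 < ν ∧ ν ≤ 1 / 64 ∧ 1 ≤ a₁ ∧ 0 < c ∧ c ≤ 1 / (8 * ((n : ℝ) ^ 2 + 1)) ∧
    ∀ (K : Type) [Field K] [NumberField K], Module.finrank ℚ K = n →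
      (∀ (T : ℝ), 1 ≤ T → ∀ u : AddChar (Additive (ClassGroup (𝓞 K))) ℂ → Finset ℂ,
        (∀ ψ, ∀ ρ ∈ u ψ, famF K ψ ρ = 0 ∧ 1 / 4 ≤ ρ.re ∧ ρ.re < 1 ∧ |ρ.im| ≤ T) →
        ∀ α : ℝ, α ≤ 1 →
          ∑ ψ, ∑ ρ ∈ u ψ with α ≤ ρ.re, (famMult K ψ ρ : ℝ) ≤
            D * Real.exp (b * (a * Real.log (ThornerZaman.condQn K) + Real.log (T + 4))) ^ (1 - α)) →
      (∀ x : ℝ, ThornerZaman.condQn K ^ a₁ ≤ x → ∀ C : ClassGroup (𝓞 K),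
          ‖(NumberField.classNumber K : ℂ) *
              (smoothedPsiClass K C (tzTest (Real.log x) (x ^ (-ν))) : ℂ) -
            fordLaplace (tzTest (Real.log x) (x ^ (-ν))) (-1)‖ ≤ η * x) ∨
      ∃ (ψ₁ : AddChar (Additive (ClassGroup (𝓞 K))) ℂ) (β₁ : ℝ), famF K ψ₁ β₁ = 0 ∧
          1 - c / (Real.log ((NumberField.discr K).natAbs : ℝ) + Real.log 4) < β₁ ∧ β₁ < 1 ∧
          (toMulHom ψ₁).toHomUnits * (toMulHom ψ₁).toHomUnits = 1 ∧
          ∀ x : ℝ, ThornerZaman.condQn K ^ a₁ ≤ x → ∀ C : ClassGroup (𝓞 K),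
            ‖(NumberField.classNumber K : ℂ) *
                (smoothedPsiClass K C (tzTest (Real.log x) (x ^ (-ν))) : ℂ) -
              fordLaplace (tzTest (Real.log x) (x ^ (-ν))) (-1) +
              ψ₁ (Additive.ofMul C⁻¹) * fordLaplace (tzTest (Real.log x) (x ^ (-ν))) (-(β₁ : ℂ))‖ ≤
            η * x := by
  classical
  obtain ⟨ν, a₀, A₀, hν0, hν64, ha₀1, hA₀, hZ⟩ := fam_zeroSum_le_local n hn hb hD ha
  obtain ⟨c₀, hc₀, hpack⟩ := exists_exceptionalZero_const n
  obtain ⟨Al, hAl0, hAl⟩ := exists_norm_logDeriv_classGroupLFunction_left_le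
  obtain ⟨M, hM1, hM⟩ := TZWeight.exists_smoothTransition_deriv_bound
  have hlC := leftLineConst_nonneg
  set c : ℝ := min c₀ (1 / (8 * ((n : ℝ) ^ 2 + 1))) with hcdef
  have hc : 0 < c := lt_min hc₀ (by positivity)
  have hcc₀ : c ≤ c₀ := min_le_left _ _
  have hcn : c ≤ 1 / (8 * ((n : ℝ) ^ 2 + 1)) := min_le_right _ _
  -- thresholds
  set Λ : ℝ := max 1 (Real.log (8 * A₀ / η)) with hΛ
  have hΛ0 : 0 ≤ Λ := le_trans zero_le_one (le_max_left _ _)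
  set Λ₂ : ℝ := max 1 (4 * Real.log (4608 / η)) with hΛ₂
  set CJ : ℝ := 8 * leftLineConst * Al * ((n : ℝ) + 1) * M with hCJ
  have hM0 : 0 ≤ M := by linarith
  have hCJ0 : 0 ≤ CJ := by positivity
  set Λ₃ : ℝ := max 1 (2 * Real.log (4 * (CJ + 1) / η)) with hΛ₃
  set a₁ : ℝ := max (max (max a₀ 32) (max (4 * a * Λ / c) (2 * Λ ^ 2 / c)))
    (max (Λ / (2 * ν)) (max Λ₂ Λ₃)) with ha₁
  have ha₁a₀ : a₀ ≤ a₁ := le_trans (le_trans (le_max_left _ _) (le_max_left _ _)) (le_max_left _ _)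
  have ha₁32 : (32 : ℝ) ≤ a₁ := le_trans (le_trans (le_max_right _ _) (le_max_left _ _)) (le_max_left _ _)
  have ha₁i : 4 * a * Λ / c ≤ a₁ := le_trans (le_trans (le_max_left _ _) (le_max_right _ _)) (le_max_left _ _)
  have ha₁i' : 2 * Λ ^ 2 / c ≤ a₁ := le_trans (le_trans (le_max_right _ _) (le_max_right _ _)) (le_max_left _ _)
  have ha₁ii : Λ / (2 * ν) ≤ a₁ := le_trans (le_max_left _ _) (le_max_right _ _)
  have ha₁iii : Λ₂ ≤ a₁ := le_trans (le_trans (le_max_left _ _) (le_max_right _ _)) (le_max_right _ _)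
  have ha₁iv : Λ₃ ≤ a₁ := le_trans (le_trans (le_max_right _ _) (le_max_right _ _)) (le_max_right _ _)
  have ha₁1 : (1 : ℝ) ≤ a₁ := by linarith
  refine ⟨ν, a₁, c, hν0, hν64, ha₁1, hc, hcn, fun K _ _ hKn hdens ↦ ?_⟩
  -- sizes depending on `K` only
  have hK : 1 < Module.finrank ℚ K := by rw [hKn]; exact hn
  set Q : ℝ := ThornerZaman.condQn K with hQ
  have hQ12 : (12 : ℝ) ≤ Q := ThornerZaman.twelve_le_condQn (K := K) hK
  have hQ1 : (1 : ℝ) < Q := by linarith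
  have hlog12 : (2 : ℝ) ≤ Real.log 12 := by
    rw [Real.le_log_iff_exp_le (by norm_num)]
    have := Real.exp_one_lt_d9
    have h : Real.exp 2 = Real.exp 1 * Real.exp 1 := by rw [← Real.exp_add]; norm_num
    rw [h]; nlinarith [Real.exp_pos (1:ℝ)]
  have hlogQ : 2 ≤ Real.log Q := hlog12.trans (Real.log_le_log (by norm_num) hQ12)
  have hlogQ0 : 0 < Real.log Q := by linarith
  -- the Landau–Page package at `c₀`, and clause (1) at `c`
  obtain ⟨hLPreal, hLPuniq, hLPsimple⟩ := hpack K hKn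
  have hpack_c : ∀ (χ : ClassGroup (𝓞 K) →* ℂˣ) (ρ : ℂ),
      (((χ = 1 → dedekindZeta₁ K ρ = 0) ∧ (χ ≠ 1 → classGroupLFunction₀ K χ ρ = 0)) ∧
        1 - c / (Real.log ((NumberField.discr K).natAbs : ℝ) + Real.log (|ρ.im| + 4)) < ρ.re) →
        ρ.im = 0 ∧ χ * χ = 1 :=
    fun χ ρ h ↦ hLPreal χ ρ ⟨h.1, lpRegion_mono hcc₀ h.2⟩
  -- an exceptional zero of the family gives the package's predicate at `c₀`
  have hexcZ : ∀ ψ ρ, famF K ψ ρ = 0 → excRegion c K ρ →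
      (((toMulHom ψ).toHomUnits = 1 → dedekindZeta₁ K ρ = 0) ∧
        ((toMulHom ψ).toHomUnits ≠ 1 → classGroupLFunction₀ K (toMulHom ψ).toHomUnits ρ = 0)) ∧
        1 - c₀ / (Real.log ((NumberField.discr K).natAbs : ℝ) + Real.log (|ρ.im| + 4)) < ρ.re := by
    intro ψ ρ h0 hexc
    refine ⟨famZ_of_famF_eq_zero ψ h0, lpRegion_mono hcc₀ ?_⟩
    obtain ⟨him, hre⟩ := hexc
    rw [him, abs_zero, zero_add]; exact hre
  -- the estimate for every `x ≥ Q^{a₁}`, every `C` and every admissible choice of `Exc`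
  have hcore : ∀ x : ℝ, Q ^ a₁ ≤ x → ∀ (C : ClassGroup (𝓞 K))
      (Exc : AddChar (Additive (ClassGroup (𝓞 K))) ℂ → Finset ℂ),
      (∀ ψ, ∀ ρ ∈ Exc ψ, famF K ψ ρ = 0 ∧ 0 < ρ.re ∧ ρ.re < 1) →
      (∀ ψ ρ, famF K ψ ρ = 0 → 0 < ρ.re → ρ.re < 1 → excRegion c K ρ → ρ ∈ Exc ψ) →
      ‖(NumberField.classNumber K : ℂ) * (smoothedPsiClass K C (tzTest (Real.log x) (x ^ (-ν))) : ℂ) -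
          fordLaplace (tzTest (Real.log x) (x ^ (-ν))) (-1) +
          ∑ ψ : AddChar (Additive (ClassGroup (𝓞 K))) ℂ, ψ (Additive.ofMul C⁻¹) *
            ∑ ρ ∈ Exc ψ, (famMult K ψ ρ : ℂ) * fordLaplace (tzTest (Real.log x) (x ^ (-ν))) (-ρ)‖ ≤
        η * x := by
    intro x hx C Exc hExc hExc'
    have hxa₀ : Q ^ a₀ ≤ x := le_trans (Real.rpow_le_rpow_of_exponent_le hQ1.le ha₁a₀) hx
    have hxQ : Q ≤ x := by
      have : Q ^ (1 : ℝ) ≤ Q ^ a₁ := Real.rpow_le_rpow_of_exponent_le hQ1.le ha₁1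
      rw [Real.rpow_one] at this; linarith
    have hx1 : 1 < x := by linarith
    have hx0 : 0 < x := by linarith
    set L : ℝ := Real.log x with hL
    have hLQ : a₁ * Real.log Q ≤ L := by
      have := Real.log_le_log (by positivity) hx
      rwa [Real.log_rpow (by linarith)] at this
    have hL2a : 2 * a₁ ≤ L := by nlinarith
    have hL64 : 64 ≤ L := by nlinarith
    have hL0 : 0 < L := by linarith
    have hexpL : Real.exp L = x := by rw [hL, Real.exp_log hx0]
    have hQexp : Q ≤ Real.exp (L / 8) := by
      refine le_exp_of_log_le (by linarith) ?_
      rw [le_div_iff₀ (by norm_num)]; nlinarith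
    -- `ε = x^{−ν}`
    set ε : ℝ := x ^ (-ν) with hε
    have hε0 : 0 < ε := Real.rpow_pos_of_pos hx0 _
    have hε1 : ε ≤ 1 := Real.rpow_le_one_of_one_le_of_nonpos hx1.le (by linarith)
    have hεL : ε < L / 2 := by linarith
    have hεexp : ε = Real.exp (-(ν * L)) := by
      rw [hε, Real.rpow_def_of_pos hx0, ← hL]; ring_nf
    -- the family zero sum and the per-member junk bounds
    have hBf := hZ c hc K hKn hpack_c hdens x hxa₀ ε le_rfl hε1
    have hM₀ : ∀ ψ : AddChar (Additive (ClassGroup (𝓞 K))) ℂ,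
        (famMult K ψ 0 : ℝ) * (L + ε) ≤ 1152 * Real.exp (L / 4) :=
      fun ψ ↦ famMult_zero_term_le hK ψ (by linarith) hε0.le hε1 hQexp
    have hJ0 : ‖dzEFRemainder K (tzTest L ε) 0‖ ≤ CJ := by
      have hJ := leftLine_term_le_one hAl0 hAl hM K hK hL0 hε0 hεL hε1 hν64 hεexp hQexp
      rw [hKn] at hJ; rw [hCJ]; exact hJ
    have hJ : ∀ ψ : AddChar (Additive (ClassGroup (𝓞 K))) ℂ, ψ ≠ 0 →
        ‖cgEFRemainder (toMulHom ψ).toHomUnits (tzTest L ε) 0‖ ≤ CJ := by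
      intro ψ hψ
      have hJ := leftLine_term_le hAl0 hAl hM K hK (toHomUnits_ne_one hψ) hL0 hε0 hεL hε1 hν64 hεexp hQexp
      rw [hKn] at hJ; rw [hCJ]; exact hJ
    have hest := norm_classNumber_mul_smoothedPsiClass_sub_le hx1 hε0 hεL C Exc hExc hExc' hBf hM₀ hJ0 hJ
    -- numerics: each of the four terms is `≤ η x / 4` (the second `≤ η x / 8`)
    have heΛ : Real.exp (-Λ) ≤ η / (8 * A₀) := by
      refine exp_neg_le_of_neg_log_le (by positivity) ?_
      rw [← Real.log_inv, inv_div]; exact le_max_right _ _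
    have hi : A₀ * x * (Real.exp (-(c * Real.log x / (4 * a * Real.log (ThornerZaman.condQn K)))) +
        Real.exp (-Real.sqrt (c * Real.log x / 4))) ≤ η / 4 * x := by
      have h := zeroSum_main_small hc ha hA₀ hΛ0 hlogQ0 hL0 hLQ hL2a ha₁i ha₁i' heΛ
      show A₀ * x * (Real.exp (-(c * L / (4 * a * Real.log Q))) + Real.exp (-Real.sqrt (c * L / 4))) ≤ η / 4 * x
      have := mul_le_mul_of_nonneg_left h hx0.le
      calc A₀ * x * (Real.exp (-(c * L / (4 * a * Real.log Q))) + Real.exp (-Real.sqrt (c * L / 4)))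
          = x * (A₀ * (Real.exp (-(c * L / (4 * a * Real.log Q))) + Real.exp (-Real.sqrt (c * L / 4)))) := by
            ring
        _ ≤ x * (η / 4) := this
        _ = η / 4 * x := by ring
    have hii : A₀ * x ^ (1 - ν) ≤ η / 8 * x := by
      have hxν : x ^ (1 - ν) = x * Real.exp (-(ν * L)) := by
        rw [← hεexp, hε, sub_eq_add_neg, Real.rpow_add hx0, Real.rpow_one]
      have hνL : Λ ≤ ν * L := by
        have := (div_le_iff₀ (by positivity)).1 ha₁ii; nlinarith
      have h1 : Real.exp (-(ν * L)) ≤ η / (8 * A₀) := (Real.exp_le_exp.2 (neg_le_neg hνL)).trans heΛ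
      rw [hxν]
      calc A₀ * (x * Real.exp (-(ν * L))) ≤ A₀ * (x * (η / (8 * A₀))) :=
            mul_le_mul_of_nonneg_left (mul_le_mul_of_nonneg_left h1 hx0.le) hA₀.le
        _ = η / 8 * x := by field_simp
    -- `h ≤ Q⁴ ≤ e^{L/2}`
    have hh : (NumberField.classNumber K : ℝ) ≤ Real.exp (L / 2) := by
      have h1 := ThornerZaman.classNumber_le_condQn_pow (K := K) hK
      rw [← hQ] at h1
      refine h1.trans ?_
      calc Q ^ 4 ≤ Real.exp (L / 8) ^ 4 := by gcongr
        _ = Real.exp (L / 2) := by rw [← Real.exp_nat_mul]; ring_nf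
    have hh0 : (0 : ℝ) ≤ NumberField.classNumber K := Nat.cast_nonneg _
    have hiii : (NumberField.classNumber K : ℝ) * (1152 * Real.exp (L / 4)) ≤ η / 4 * x := by
      have he : 4608 / η ≤ Real.exp (L / 4) := by
        refine le_exp_of_log_le (by positivity) ?_
        have := le_max_right 1 (4 * Real.log (4608 / η)); rw [← hΛ₂] at this
        rw [le_div_iff₀ (by norm_num)]; nlinarith
      have hsplit : x = Real.exp (L / 2) * Real.exp (L / 4) * Real.exp (L / 4) := by
        rw [← Real.exp_add, ← Real.exp_add, ← hexpL]; ring_nf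
      calc (NumberField.classNumber K : ℝ) * (1152 * Real.exp (L / 4))
          ≤ Real.exp (L / 2) * (1152 * Real.exp (L / 4)) := mul_le_mul_of_nonneg_right hh (by positivity)
        _ = η / 4 * (Real.exp (L / 2) * Real.exp (L / 4) * (4608 / η)) := by field_simp; ring
        _ ≤ η / 4 * (Real.exp (L / 2) * Real.exp (L / 4) * Real.exp (L / 4)) := by
            refine mul_le_mul_of_nonneg_left (mul_le_mul_of_nonneg_left he (by positivity)) (by positivity)
        _ = η / 4 * x := by rw [← hsplit]
    have hiv : (NumberField.classNumber K : ℝ) * CJ ≤ η / 4 * x := by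
      have he : 4 * (CJ + 1) / η ≤ Real.exp (L / 2) := by
        refine le_exp_of_log_le (by positivity) ?_
        have := le_max_right 1 (2 * Real.log (4 * (CJ + 1) / η)); rw [← hΛ₃] at this
        rw [le_div_iff₀ (by norm_num)]; nlinarith
      have hsplit : x = Real.exp (L / 2) * Real.exp (L / 2) := by
        rw [← Real.exp_add, ← hexpL]; ring_nf
      calc (NumberField.classNumber K : ℝ) * CJ ≤ Real.exp (L / 2) * CJ := mul_le_mul_of_nonneg_right hh hCJ0
        _ ≤ Real.exp (L / 2) * (CJ + 1) := by nlinarith [Real.exp_pos (L / 2)]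
        _ = η / 4 * (Real.exp (L / 2) * (4 * (CJ + 1) / η)) := by field_simp
        _ ≤ η / 4 * (Real.exp (L / 2) * Real.exp (L / 2)) :=
            mul_le_mul_of_nonneg_left (mul_le_mul_of_nonneg_left he (by positivity)) (by positivity)
        _ = η / 4 * x := by rw [← hsplit]
    refine hest.trans ?_
    have : (NumberField.classNumber K : ℝ) * (1152 * Real.exp (L / 4) + CJ) ≤ η / 4 * x + η / 4 * x := by
      rw [mul_add]; exact add_le_add hiii hiv
    have hηx : 0 < η * x := mul_pos hη hx0
    linarith
  -- the dichotomy on the exceptional zero of the family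
  by_cases hex : ∃ (ψ : AddChar (Additive (ClassGroup (𝓞 K))) ℂ) (ρ : ℂ),
      famF K ψ ρ = 0 ∧ 0 < ρ.re ∧ ρ.re < 1 ∧ excRegion c K ρ
  · -- an exceptional zero `(ψ₁, ρ₁)`: real, unique, simple
    right
    obtain ⟨ψ₁, ρ₁, h0₁, hre₁, hre₁', hexc₁⟩ := hex
    have hZ₁ := hexcZ ψ₁ ρ₁ h0₁ hexc₁
    obtain ⟨him₁, hreal₁⟩ := hLPreal _ ρ₁ hZ₁
    set β₁ : ℝ := ρ₁.re with hβ₁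
    have hρ₁ : ρ₁ = (β₁ : ℂ) := by
      apply Complex.ext <;> simp [hβ₁, him₁]
    have hmult : famMult K ψ₁ ρ₁ = 1 := by
      obtain ⟨hs1, hs2⟩ := hLPsimple _ ρ₁ hZ₁
      by_cases hψ : ψ₁ = 0
      · subst hψ
        have h := hs1 toHomUnits_toMulHom_zero
        have hne : analyticOrderAt (dedekindZeta₁ K) ρ₁ ≠ ⊤ := by rw [h]; exact ENat.one_ne_top
        have : (analyticOrderNatAt (dedekindZeta₁ K) ρ₁ : ℕ∞) = 1 := by
          rw [Nat.cast_analyticOrderNatAt hne, h]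
        rw [famMult, famF_zero]; exact_mod_cast this
      · have h := hs2 (toHomUnits_ne_one hψ)
        have hne : analyticOrderAt (classGroupLFunction₀ K (toMulHom ψ₁).toHomUnits) ρ₁ ≠ ⊤ := by
          rw [h]; exact ENat.one_ne_top
        have : (analyticOrderNatAt (classGroupLFunction₀ K (toMulHom ψ₁).toHomUnits) ρ₁ : ℕ∞) = 1 := by
          rw [Nat.cast_analyticOrderNatAt hne, h]
        rw [famMult, famF_of_ne hψ]; exact_mod_cast this
    refine ⟨ψ₁, β₁, by rw [← hρ₁]; exact h0₁, hexc₁.2, hre₁', hreal₁, fun x hx C ↦ ?_⟩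
    -- `Exc ψ = {ρ₁}` for `ψ = ψ₁`, `∅` otherwise
    set Exc : AddChar (Additive (ClassGroup (𝓞 K))) ℂ → Finset ℂ :=
      fun ψ ↦ if ψ = ψ₁ then {ρ₁} else ∅ with hExcdef
    have hExc : ∀ ψ, ∀ ρ ∈ Exc ψ, famF K ψ ρ = 0 ∧ 0 < ρ.re ∧ ρ.re < 1 := by
      intro ψ ρ hρ
      rw [hExcdef] at hρ; dsimp only at hρ
      split_ifs at hρ with hψ
      · rw [Finset.mem_singleton] at hρ; subst hρ; subst hψ; exact ⟨h0₁, hre₁, hre₁'⟩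
      · simp at hρ
    have hExc' : ∀ ψ ρ, famF K ψ ρ = 0 → 0 < ρ.re → ρ.re < 1 → excRegion c K ρ → ρ ∈ Exc ψ := by
      intro ψ ρ h0 _ _ hexc
      have hZ := hexcZ ψ ρ h0 hexc
      obtain ⟨hχ, hρρ⟩ := hLPuniq _ _ ρ ρ₁ hZ hZ₁
      have hψ : ψ = ψ₁ := toHomUnits_toMulHom_injective hχ
      rw [hExcdef]; dsimp only; rw [if_pos hψ, Finset.mem_singleton]; exact hρρ
    have key := hcore x hx C Exc hExc hExc'
    have hsum : ∑ ψ : AddChar (Additive (ClassGroup (𝓞 K))) ℂ, ψ (Additive.ofMul C⁻¹) *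
        ∑ ρ ∈ Exc ψ, (famMult K ψ ρ : ℂ) * fordLaplace (tzTest (Real.log x) (x ^ (-ν))) (-ρ) =
        ψ₁ (Additive.ofMul C⁻¹) * fordLaplace (tzTest (Real.log x) (x ^ (-ν))) (-(β₁ : ℂ)) := by
      rw [Finset.sum_eq_single ψ₁]
      · rw [hExcdef]; dsimp only; rw [if_pos rfl, Finset.sum_singleton, hmult, ← hρ₁]; push_cast; ring
      · intro ψ _ hψ
        rw [hExcdef]; dsimp only; rw [if_neg hψ, Finset.sum_empty, mul_zero]
      · intro h; exact absurd (Finset.mem_univ _) h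
    rw [hsum] at key
    exact key
  · -- no exceptional zero
    left
    intro x hx C
    have key := hcore x hx C (fun _ ↦ ∅) (fun ψ ρ hρ ↦ by simp at hρ)
      (fun ψ ρ h0 h1 h2 hexc ↦ absurd ⟨ψ, ρ, h0, h1, h2, hexc⟩ hex)
    simpa only [Finset.sum_empty, mul_zero, Finset.sum_const_zero, add_zero] using key

end Summit.QuantumAdvantage.QuantumAdvantage.Theorems.DegreeOnePrimesEscape

end
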